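import Summits.ResolutionOfSingularities.ResolutionOfSingularities.Theorems.FrobeniusLadderFInjectiveMacaulayficationHypersurfaceFullClClosedPoints
import Summits.ResolutionOfSingularities.ResolutionOfSingularities.Theorems.FrobeniusLadderFInjectiveMacaulayficationFedderCriterion
import HarnessLib

/-!
# GAP-2 for HYPERSURFACE CHARTS, ALL POINTS: FULL at EVERY point of `V(Φ)` (closed or not, any residue field) from FULL at the rational points over an algebraically closed extension
# (crux `FInjectiveMacaulayfication` stmt-ResolutionOfSingularities-15315, chain w45a; res-L1-w45a-plan-1 RULING R23.16 (r2) and its «every point» remainder; seat res-L1-w45a-stub-3 g13;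
# companion of ✓p703451 `HypersurfaceFullClClosedPoints` (closed points); consumer: the Ω₁ local cure row ✓p702704)

[OURS · L1 W4.5a] Support file (`--supports stmt-ResolutionOfSingularities-15315 --as helper`); theorems only; no definitions, no named facts; unconditional. Nothing of the crux is proved;
no census row is asserted. AI-written (AI review is weaker than expert review).

THE ARGUMENT. `S = k[X₁..X_m]` (regular, Jacobson), `Φ ∈ S` prime, `y` ANY point of `V(Φ)`, `Q = 𝔭_y ∩ S` (a prime ∋ `Φ`), `R = S_Q` regular local. Fedderʼs criterion in `R` (✓ `Fedder.fedder_hypersurface_clause_iff`,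
any regular local ring): `R/(Φ)` satisfies the stalk clause iff `Φ^{p−1} ∉ (Q R)^{[p]}`; and `R/(Φ) ≅ (S/Φ)_{𝔭_y} ≅ 𝒪_{V(Φ),y}` (✓ `stub_quotLocalizationIso`, `Spec.stalkIso`) (§3). If `Φ^{p−1} ∈ (QR)^{[p]} = Q^{[p]}R`
then `u·Φ^{p−1} ∈ Q^{[p]}` for some `u ∉ Q`; `S` is Jacobson, so some MAXIMAL `P ⊇ Q` misses `u`; `Q^{[p]} ⊆ P^{[p]}` and `P^{[p]}` is `P`-primary, so `Φ^{p−1} ∈ P^{[p]}` (§2) — contradicting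
Fedderʼs test at the maximal ideal `P`, which holds by the geometric argument of ✓p703451 (§1: generators of `P`, a `K`-point under `P`, FULL at that rational point of `V(Φ_K)`, necessity).
* §1 `fedder_maximal_of_geom_fedder`; §2 `fedder_prime_of_fedder_maximal`; §3 ★ `hypersurface_fullCl_stalk_of_fedder_prime`; §4 ★★ `hypersurface_fullCl_of_geom_fedder`,
  ★★★ `hypersurface_fullCl_of_rational_over_algClosed` (every point).
[cite: Fedder1983, Prop. 1.7 and Thm. 1.12] [cite: Matsumura1987, Thm. 5.3 and §5 (Jacobson property of finitely generated algebras)]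
-/

set_option linter.dupNamespace false

noncomputable section

open AlgebraicGeometry IsLocalRing MvPolynomial
open scoped Pointwise

namespace Summit.ResolutionOfSingularities.ResolutionOfSingularities.Theorems.FInjectiveMacaulayfication.HypersurfaceFullClAllPoints

open Summit.ResolutionOfSingularities.ResolutionOfSingularities.Theorems.FInjectiveMacaulayfication
open SliceableCentre Literature.RingTheory.TightClosure HypersurfaceFullClClosedPoints

variable (k : Type) [Field k] (K : Type) [Field K] [Algebra k K]

/-! ## §1 Fedderʼs test at every maximal ideal from the geometric test -/

/-- **Fedderʼs test at EVERY maximal ideal `P ∋ Φ` of `k[X]`** (`Φ^{p−1} ∉ P^{[p]}`) from the test at every `K`-point of `V(Φ_K)`, `K ⊇ k` algebraically closed. [OURS; cite: Fedder1983, Thm. 1.12] -/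
theorem fedder_maximal_of_geom_fedder (p : ℕ) [Fact p.Prime] [CharP k p] [IsAlgClosed K] {m : ℕ} (Φ : MvPolynomial (Fin m) k)
    (hK : ∀ c : Fin m → K, eval c (map (algebraMap k K) Φ) = 0 →
      (map (algebraMap k K) Φ) ^ (p - 1) ∉ Ideal.span (Set.range fun j : Fin m => ((X j : MvPolynomial (Fin m) K) - C (c j)) ^ p))
    (P : Ideal (MvPolynomial (Fin m) k)) [P.IsMaximal] (hΦP : Φ ∈ P) : Φ ^ (p - 1) ∉ frobeniusPower p P := by
  haveI : CharP K p := charP_of_injective_algebraMap (algebraMap k K).injective p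
  haveI := ExpChar.prime (R := MvPolynomial (Fin m) k) (Fact.out : p.Prime)
  obtain ⟨m', a, ha⟩ := Submodule.fg_iff_exists_fin_generating_family.1 (IsNoetherian.noetherian P)
  have ha' : P = Ideal.span (Set.range a) := ha.symm
  have hPp : frobeniusPower p P = Ideal.span (Set.range fun i => a i ^ p) := by
    have h := frobeniusPower_span (R := MvPolynomial (Fin m) k) p 1 (Set.range a)
    rw [pow_one, ← ha', ← Set.range_comp] at h
    exact h
  rw [hPp]
  intro hfed
  obtain ⟨c, hc⟩ := exists_geom_point_of_isMaximal k K P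
  refine hK c (hc Φ hΦP) ?_
  have h1 := map_pow_mem_span_pow (map (algebraMap k K)) p (p - 1) a Φ hfed
  refine (Ideal.span_le.2 ?_) h1
  rintro _ ⟨i, rfl⟩
  exact pow_mem_span_pow_of_mem_span p _ _ (PencilExitTagMaster.mem_span_of_eval_eq_zero K c _ (hc (a i) (ha' ▸ Ideal.subset_span ⟨i, rfl⟩)))

/-! ## §2 From the maximal ideals to every prime (Jacobson + primary contraction) -/

/-- **Fedderʼs test at a PRIME `Q ∋ g` of `k[X]` in the local ring `k[X]_Q`** from the test at every maximal ideal above `Q`: `k[X]` is Jacobson and `P^{[p]}` is `P`-primary. [OURS; cite: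
Fedder1983, Prop. 1.7; Matsumura1987, §5] -/
theorem fedder_prime_of_fedder_maximal (p : ℕ) [Fact p.Prime] [CharP k p] {m : ℕ} (g : MvPolynomial (Fin m) k) (Q : Ideal (MvPolynomial (Fin m) k)) [Q.IsPrime]
    (hmax : ∀ P : Ideal (MvPolynomial (Fin m) k), P.IsMaximal → Q ≤ P → g ^ (p - 1) ∉ frobeniusPower p P)
    [CharP (Localization.AtPrime Q) p] :
    algebraMap (MvPolynomial (Fin m) k) (Localization.AtPrime Q) g ^ (p - 1) ∉ frobeniusPower p (maximalIdeal (Localization.AtPrime Q)) := by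
  haveI := ExpChar.prime (R := MvPolynomial (Fin m) k) (Fact.out : p.Prime)
  haveI := ExpChar.prime (R := Localization.AtPrime Q) (Fact.out : p.Prime)
  have hp0 : p ≠ 0 := (Fact.out : p.Prime).ne_zero
  have hinj : Function.Injective (algebraMap (MvPolynomial (Fin m) k) (Localization.AtPrime Q)) :=
    IsLocalization.injective (Localization.AtPrime Q) Q.primeCompl_le_nonZeroDivisors
  rw [← IsLocalization.AtPrime.map_eq_maximalIdeal Q (Localization.AtPrime Q), ← pow_one p, Fedder.frobeniusPower_map p _ 1, pow_one, ← map_pow]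
  intro hmem
  rw [IsLocalization.mem_map_algebraMap_iff Q.primeCompl (Localization.AtPrime Q)] at hmem
  obtain ⟨⟨⟨b, hb⟩, ⟨u, hu⟩⟩, h⟩ := hmem
  dsimp only at h
  rw [← map_mul] at h
  have h' : g ^ (p - 1) * u ∈ frobeniusPower p Q := by rw [hinj h]; exact hb
  -- a maximal ideal above `Q` missing `u`
  have hJ : Q.jacobson = Q := IsJacobsonRing.out inferInstance (Ideal.IsPrime.isRadical inferInstance)
  have huQ : u ∉ Q.jacobson := by rw [hJ]; exact hu
  rw [Ideal.jacobson, Ideal.mem_sInf] at huQ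
  push Not at huQ
  obtain ⟨P, ⟨hQP, hPmax⟩, huP⟩ := huQ
  -- `P^{[p]}` is `P`-primary
  have hle : frobeniusPower p P ≤ P := frobeniusPower_le hp0 P
  have hrad : (frobeniusPower p P).radical = P := by
    refine le_antisymm (hPmax.isPrime.radical_le_iff.mpr hle) fun x hx => ⟨p, pow_mem_frobeniusPower hx⟩
  have hprim : (frobeniusPower p P).IsPrimary := Ideal.isPrimary_of_isMaximal_radical (by rw [hrad]; exact hPmax)
  rcases (Ideal.isPrimary_iff.mp hprim).2 (frobeniusPower_mono p hQP h') with h1 | h1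
  · exact hmax P hPmax hQP h1
  · exact huP (hrad ▸ h1)

/-! ## §3 Fedder sufficiency at an arbitrary point of a hypersurface -/

/-- ★ **A HYPERSURFACE IS FULL AT ANY POINT CARRYING FEDDERʼS TEST IN THE LOCAL RING UPSTAIRS**: `g ∈ k[X]` prime, `y` any point of `V(g)`, `Q = 𝔭_y ∩ k[X]`; if `g^{p−1} ∉ (Q k[X]_Q)^{[p]}` then
`𝒪_{V(g),y}` is `FullCl p`. (✓ `Fedder.fedder_hypersurface_clause_iff` in the regular local ring `k[X]_Q`, transported along `k[X]_Q/(g) ≅ (k[X]/g)_{𝔭_y} ≅ 𝒪_{V(g),y}`.)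
[cite: Fedder1983, Prop. 1.7 and Thm. 1.12] -/
theorem hypersurface_fullCl_stalk_of_fedder_prime (p : ℕ) [Fact p.Prime] [CharP k p] {m : ℕ} (g : MvPolynomial (Fin m) k) (hg : Prime g)
    (y : Spec (.of (MvPolynomial (Fin m) k ⧸ Ideal.span {g})))
    (hfed : ∀ [CharP (Localization.AtPrime (y.asIdeal.comap (Ideal.Quotient.mk (Ideal.span {g})))) p],
      algebraMap (MvPolynomial (Fin m) k) (Localization.AtPrime (y.asIdeal.comap (Ideal.Quotient.mk (Ideal.span {g})))) g ^ (p - 1) ∉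
        frobeniusPower p (maximalIdeal (Localization.AtPrime (y.asIdeal.comap (Ideal.Quotient.mk (Ideal.span {g})))))) :
    FullCl p ((Spec (.of (MvPolynomial (Fin m) k ⧸ Ideal.span {g}))).presheaf.stalk y) := by
  set Q := y.asIdeal.comap (Ideal.Quotient.mk (Ideal.span {g})) with hQ
  haveI : IsRegularLocalRing (Localization.AtPrime Q) := IsRegularRing.isRegularLocalRing_localization Q
  have hinj : Function.Injective (algebraMap (MvPolynomial (Fin m) k) (Localization.AtPrime Q)) :=
    IsLocalization.injective (Localization.AtPrime Q) Q.primeCompl_le_nonZeroDivisors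
  haveI : CharP (Localization.AtPrime Q) p := charP_of_injective_algebraMap hinj p
  have hgQ : g ∈ Q := by
    rw [hQ, Ideal.mem_comap, Ideal.Quotient.eq_zero_iff_mem.mpr (Ideal.mem_span_singleton_self g)]
    exact y.asIdeal.zero_mem
  have hgm : algebraMap (MvPolynomial (Fin m) k) (Localization.AtPrime Q) g ∈ maximalIdeal (Localization.AtPrime Q) := by
    rw [← IsLocalization.AtPrime.map_eq_maximalIdeal Q (Localization.AtPrime Q)]
    exact Ideal.mem_map_of_mem _ hgQ
  have hg0' : algebraMap (MvPolynomial (Fin m) k) (Localization.AtPrime Q) g ≠ 0 := fun h => hg.ne_zero (hinj (by rw [h, map_zero]))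
  have hL := (Fedder.fedder_hypersurface_clause_iff p hgm hg0').mpr hfed
  obtain ⟨e₁⟩ := QuotLocalizationIso.stub_quotLocalizationIso (MvPolynomial (Fin m) k) g Q y.asIdeal rfl
  have hclause := DegreeZeroDescent.inlineClause_of_ringEquiv p e₁ hL
  haveI := (Ideal.span_singleton_prime hg.ne_zero).mpr hg
  haveI : IsDomain (MvPolynomial (Fin m) k ⧸ Ideal.span {g}) := Ideal.Quotient.isDomain _
  haveI : IsDomain (Localization.AtPrime y.asIdeal) := IsLocalization.isDomain_of_le_nonZeroDivisors _ y.asIdeal.primeCompl_le_nonZeroDivisors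
  have hloc : FullCl p (Localization.AtPrime y.asIdeal) := ⟨inferInstance, hclause⟩
  exact WFixAtNonClosedDimTwo.fullCl_of_ringEquiv p (Spec.stalkIso (.of _) y).commRingCatIsoToRingEquiv.symm hloc

/-! ## §4 ★★★ FULL at every point -/

/-- ★★ **FULL AT EVERY POINT FROM THE GEOMETRIC FEDDER TEST**: `Φ ∈ k[X₁..X_m]` prime, `K ⊇ k` algebraically closed; if `Φ_K^{p−1} ∉ ((X_j − c_j)^p)` at every `K`-point `c` of `V(Φ_K)`,
then `V(Φ)` is `FullCl p` at EVERY point. [OURS · GAP-2 engine; cite: Fedder1983, Thm. 1.12] -/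
theorem hypersurface_fullCl_of_geom_fedder (p : ℕ) [Fact p.Prime] [CharP k p] [IsAlgClosed K] {m : ℕ} (Φ : MvPolynomial (Fin m) k) (hΦ : Prime Φ)
    (hK : ∀ c : Fin m → K, eval c (map (algebraMap k K) Φ) = 0 →
      (map (algebraMap k K) Φ) ^ (p - 1) ∉ Ideal.span (Set.range fun j : Fin m => ((X j : MvPolynomial (Fin m) K) - C (c j)) ^ p))
    (y : Spec (.of (MvPolynomial (Fin m) k ⧸ Ideal.span {Φ}))) :
    FullCl p ((Spec (.of (MvPolynomial (Fin m) k ⧸ Ideal.span {Φ}))).presheaf.stalk y) := by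
  refine hypersurface_fullCl_stalk_of_fedder_prime k p Φ hΦ y ?_
  intro _
  have hΦQ : Φ ∈ y.asIdeal.comap (Ideal.Quotient.mk (Ideal.span {Φ})) := by
    rw [Ideal.mem_comap, Ideal.Quotient.eq_zero_iff_mem.mpr (Ideal.mem_span_singleton_self Φ)]
    exact y.asIdeal.zero_mem
  exact fedder_prime_of_fedder_maximal k p Φ _ (fun P hP hQP => by
    haveI := hP
    exact fedder_maximal_of_geom_fedder k K p Φ hK P (hQP hΦQ))

/-- ★★★ **FULL AT EVERY POINT FROM FULL AT THE RATIONAL POINTS OVER AN ALGEBRAICALLY CLOSED EXTENSION**: `Φ ∈ k[X₁..X_m]` prime, `K ⊇ k` algebraically closed, `Ψ = Φ_K`;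
if `V(Ψ)` is `FullCl p` at every closed point with coordinates in `K`, then `V(Φ)` is `FullCl p` at EVERY point (closed or not, any residue field). [OURS · GAP-2 engine; cite:
Fedder1983, Prop. 1.7 and Thm. 1.12] -/
theorem hypersurface_fullCl_of_rational_over_algClosed (p : ℕ) [Fact p.Prime] [CharP k p] [IsAlgClosed K] {m : ℕ}
    (Φ : MvPolynomial (Fin m) k) (hΦ : Prime Φ) (Ψ : MvPolynomial (Fin m) K) (hΨ : map (algebraMap k K) Φ = Ψ)
    (hrow : ∀ (c : Fin m → K) (y' : Spec (.of (MvPolynomial (Fin m) K ⧸ Ideal.span {Ψ}))), y'.asIdeal.IsMaximal →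
      y'.asIdeal.comap (Ideal.Quotient.mk (Ideal.span {Ψ})) = Ideal.span (Set.range fun j : Fin m => (X j : MvPolynomial (Fin m) K) - C (c j)) →
      FullCl p ((Spec (.of (MvPolynomial (Fin m) K ⧸ Ideal.span {Ψ}))).presheaf.stalk y'))
    (y : Spec (.of (MvPolynomial (Fin m) k ⧸ Ideal.span {Φ}))) :
    FullCl p ((Spec (.of (MvPolynomial (Fin m) k ⧸ Ideal.span {Φ}))).presheaf.stalk y) := by
  haveI : CharP K p := charP_of_injective_algebraMap (algebraMap k K).injective p
  refine hypersurface_fullCl_of_geom_fedder k K p Φ hΦ (fun c hc => ?_) y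
  rw [hΨ] at hc ⊢
  have hΨ0 : Ψ ≠ 0 := by
    rw [← hΨ]; exact fun h => hΦ.ne_zero (map_injective _ (algebraMap k K).injective (by rw [h, map_zero]))
  obtain ⟨y', hy', ha'⟩ := exists_closedPoint_of_eval_eq_zero K Ψ c hc
  exact fedder_not_mem_of_fullCl_rational K p Ψ hΨ0 c y' hy' ha' (hrow c y' hy' ha')

end Summit.ResolutionOfSingularities.ResolutionOfSingularities.Theorems.FInjectiveMacaulayfication.HypersurfaceFullClAllPoints

end
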